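import Summits.BirchSwinnertonDyer.BirchSwinnertonDyer.Theorems.BiquadraticEisensteinDescentHeegnerTwistCouplingInSupplyNonNullBasics
import Summits.BirchSwinnertonDyer.BirchSwinnertonDyer.Theorems.BiquadraticEisensteinDescentHeegnerTwistCouplingInSupplyNonNullOfMoment
import Literature.NumberTheory.QuadraticFields.ImaginaryQuadraticClassNumberValues
import Literature.NumberTheory.QuadraticFields.AmbiguousClasses
import HarnessLib

set_option linter.dupNamespace false -- `Summit.BirchSwinnertonDyer.BirchSwinnertonDyer.Theorems.…` (summit = sub, D-0017)
set_option autoImplicit false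

/-!
# Crux `HeegnerTwistCouplingInSupply` (stmt-BirchSwinnertonDyer-21381): C⁺(N, p) ⟺ POSITIVE UPPER DENSITY of `p ∤ h(D)` over the
# odd Heegner family of level `N` — the registered stub IS the residual R1, kernel-exact

Route `BiquadraticEisensteinDescent` (cell `pub/bsd-wall`; width seat `bsd-wall-cm-bed-w1` g17; theorems only, `--supports 21381`).
Registered stub C⁺ (line `size_tail` v4): `¬ twistDensity S_{N,p} 0`, `S_{N,p} d := ∃ K′ imaginary quadratic, d_{K′} = d ∧ 4 < |d| ∧ Heegner(N,K′) ∧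
p ∤ h(K′)`. The ideation/lead memos read it as «R1: positive upper density of `p ∤ h(D)` in a Heegner progression» (OBSTRUCTIONS-seat1-g22 §7,
LEAD-NOTE-ibd-p1-g6 §3). This file proves that reading is EXACT, in the carriers of the tree (`negFundDiscrs X`; the odd Heegner family
`Q_N(X) := {D ∈ negFundDiscrs X : D odd, ∃ K′ of discriminant D Heegner for N}` of `…InertBadAtThreeNonNullOddHeegner`; the computable
class number `BinQF.classNumber D` with the Cox 7.7(ii) bridge `ClassNumberValues.dvd_classNumber_iff_of_discr_eq`):

  for `N ≠ 0` and `p` prime,  C⁺(N,p)  ⟺  `∃ ε > 0, ∃ᶠ X, ε·X ≤ #{D ∈ Q_N(X) : p ∤ h(D)}`  ⟺  `∃ ε > 0, ∃ᶠ X, ε·#Q_N(X) ≤ #{D ∈ Q_N(X) : p ∤ h(D)}`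
  (`nonNull_iff_frequently_mul_le_card_indivisible`, `nonNull_iff_frequently_mul_card_le_card_indivisible`).

* ⟸ (`nonNull_of_frequently_mul_card_le_card_indivisible`): the moment bridge `…NonNullOfMoment.not_twistDensity_zero_of_frequently_moment_le` with
  the statistic `t(D) = p·[p ∣ h(D)]` and `M = p(1 − ε) < p`.
* ⟹ (`frequently_mul_le_card_indivisible_of_nonNull`): a non-negative sequence not tending to `0` is `≥ δ` frequently
  (`exists_pos_frequently_le_of_not_tendsto_zero`); the reference count is `≥ c·X` eventually (`exists_pos_eventually_mul_le_natCard_squarefree_abs_le`);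
  and the C⁺ counting set at `X` lies in `{D ∈ Q_N(X) : p ∤ h(D)} ∪ {−X}` (`natCard_cplusSet_le_card_indivisible_add_one`: a square-free discriminant
  of an imaginary quadratic field is `≡ 1 (mod 4)` — `discr_eq_sq_add_four_mul` — hence an odd negative fundamental discriminant).
* `card_oddHeegnerFamily_le : #Q_N(X) ≤ X` links the two normal forms.

HONEST FRAMING: an equivalence of formulations; C⁺ itself (`p ≥ 5`) stays OPEN (Cohen–Lenstra class); nothing about the crux or BSD is proved.
No definition, no named fact, no `sorry`; axioms standard. [cite: Cox2013, §7.B Thm. 7.7(ii)] [cite: arXiv250317619, §1]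
-/

noncomputable section

open scoped Classical
open Finset Filter Topology
open Literature.NumberTheory.QuadraticFields Literature.NumberTheory.QuadraticFields.Quadratic Literature.NumberTheory.EllipticCurves
open Summit.BirchSwinnertonDyer.BirchSwinnertonDyer.Theorems.InertBadSignedBranchesInertBadAtThreeNonNullOddHeegner
open Summit.BirchSwinnertonDyer.BirchSwinnertonDyer.Theorems.BiquadraticEisensteinDescentHeegnerTwistCouplingInSupplyNonNullBasics
open Summit.BirchSwinnertonDyer.BirchSwinnertonDyer.Theorems.BiquadraticEisensteinDescentHeegnerTwistCouplingInSupplyNonNullOfMoment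

namespace Summit.BirchSwinnertonDyer.BirchSwinnertonDyer.Theorems.BiquadraticEisensteinDescentHeegnerTwistCouplingInSupplyNonNullIffUpperDensity

/-! ## §1 Three elementary lemmas -/

/-- A non-negative real sequence that does NOT tend to `0` is `≥ δ` frequently, for some `δ > 0`. [folklore] -/
theorem exists_pos_frequently_le_of_not_tendsto_zero {u : ℕ → ℝ} (hu : ∀ n, 0 ≤ u n)
    (h : ¬ Tendsto u atTop (𝓝 0)) : ∃ δ : ℝ, 0 < δ ∧ ∃ᶠ n in atTop, δ ≤ u n := by
  by_contra hc
  push Not at hc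
  apply h
  rw [tendsto_order]
  exact ⟨fun a ha ↦ Eventually.of_forall fun n ↦ ha.trans_le (hu n), fun a ha ↦ hc a ha⟩

/-- The reference count of `twistDensity` is eventually `≥ c·X` for some `c > 0` (square-free integers in the progression `1 (mod 8)`).
[folklore] -/
theorem exists_pos_eventually_mul_le_natCard_squarefree_abs_le :
    ∃ c : ℝ, 0 < c ∧ ∀ᶠ X : ℕ in atTop, c * (X : ℝ) ≤ (Nat.card {d : ℤ | Squarefree d ∧ |d| ≤ (X : ℤ)} : ℝ) := by
  obtain ⟨c, hc0, hTc⟩ := exists_pos_tendsto_card_progression_div (N := 1) one_ne_zero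
  refine ⟨c / 2, by linarith, ?_⟩
  have h1 : ∀ᶠ X : ℕ in atTop, c / 2 < (((Ico (-(X : ℤ) + 1) 0).filter
      (fun x => x ≡ 1 [ZMOD ((8 * 1 : ℕ) : ℤ)] ∧ Squarefree x)).card : ℝ) / X :=
    (tendsto_order.1 hTc).1 _ (by linarith)
  filter_upwards [h1, eventually_gt_atTop 0] with X hX hX0
  have hX0' : (0 : ℝ) < X := by exact_mod_cast hX0
  rw [lt_div_iff₀ hX0'] at hX
  exact hX.le.trans (by exact_mod_cast card_progression_le_natCard_squarefree_abs_le X)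

/-- The odd Heegner family below `X` has at most `X` members (`negFundDiscrs X ⊆ (−X, 0)`). [folklore] -/
theorem card_oddHeegnerFamily_le (N X : ℕ) :
    ((negFundDiscrs X).filter (fun D => Odd D ∧ ∃ (K : Type) (_ : Field K) (_ : NumberField K),
        IsImaginaryQuadratic K ∧ NumberField.discr K = D ∧ SatisfiesHeegnerHypothesis N K)).card ≤ X := by
  refine (Finset.card_filter_le _ _).trans ?_
  refine (Finset.card_le_card (fun D hD ↦ ?_ : negFundDiscrs X ⊆ Finset.Ioo (-(X : ℤ)) 0)).trans ?_
  · rw [mem_negFundDiscrs] at hD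
    rw [Finset.mem_Ioo]
    exact hD.1
  · rw [Int.card_Ioo]
    omega

/-- **A square-free discriminant of an imaginary quadratic field is odd** (`d_K = t² + 4m` for an integral basis `{1, ω}`, `ω² = m + tω`;
`t` even would make `4 ∣ d_K`). [folklore] -/
theorem odd_discr_of_squarefree {K : Type*} [Field K] [NumberField K] (hK : IsImaginaryQuadratic K)
    (hsf : Squarefree (NumberField.discr K)) : Odd (NumberField.discr K) := by
  obtain ⟨b, hb⟩ := exists_basis_zero_eq_one (K := K) hK.1
  have hDK := discr_eq_sq_add_four_mul b hb
  set t : ℤ := b.repr (b 1 * b 1) 1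
  set m : ℤ := b.repr (b 1 * b 1) 0
  by_contra hodd
  rw [Int.not_odd_iff_even] at hodd
  have ht : Even t := by
    by_contra ht
    rw [Int.not_even_iff_odd] at ht
    obtain ⟨k, hk⟩ := ht
    have : Odd (NumberField.discr K) := ⟨2 * k ^ 2 + 2 * k + 2 * m, by rw [hDK, hk]; ring⟩
    exact (Int.not_odd_iff_even.mpr hodd) this
  obtain ⟨k, hk⟩ := ht
  have h4 : (2 : ℤ) * 2 ∣ NumberField.discr K := ⟨k ^ 2 + m, by rw [hDK, hk]; ring⟩
  have h2 := hsf 2 h4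
  exact absurd (Int.isUnit_iff.mp h2) (by norm_num)

/-! ## §2 The C⁺ counting set sits inside the indivisible part of the odd Heegner family -/

/-- **The C⁺ counting set at `X` is contained in `{D ∈ Q_N(X) : p ∤ h(D)} ∪ {−X}`**, hence its size is at most `#{…} + 1`.
[cite: Cox2013, §7.B Thm. 7.7(ii)] -/
theorem natCard_cplusSet_le_card_indivisible_add_one (N p X : ℕ) :
    Nat.card {d : ℤ | Squarefree d ∧ |d| ≤ (X : ℤ) ∧
        ∃ (K : Type) (_ : Field K) (_ : NumberField K), IsImaginaryQuadratic K ∧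
          NumberField.discr K = d ∧ 4 < d.natAbs ∧ SatisfiesHeegnerHypothesis N K ∧ ¬ p ∣ NumberField.classNumber K} ≤
      (((negFundDiscrs X).filter (fun D => Odd D ∧ ∃ (K : Type) (_ : Field K) (_ : NumberField K),
        IsImaginaryQuadratic K ∧ NumberField.discr K = D ∧ SatisfiesHeegnerHypothesis N K)).filter
        (fun D => ¬ p ∣ BinQF.classNumber D)).card + 1 := by
  set G := ((negFundDiscrs X).filter (fun D => Odd D ∧ ∃ (K : Type) (_ : Field K) (_ : NumberField K),
        IsImaginaryQuadratic K ∧ NumberField.discr K = D ∧ SatisfiesHeegnerHypothesis N K)).filter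
        (fun D => ¬ p ∣ BinQF.classNumber D) with hG
  have hsub : {d : ℤ | Squarefree d ∧ |d| ≤ (X : ℤ) ∧
        ∃ (K : Type) (_ : Field K) (_ : NumberField K), IsImaginaryQuadratic K ∧
          NumberField.discr K = d ∧ 4 < d.natAbs ∧ SatisfiesHeegnerHypothesis N K ∧ ¬ p ∣ NumberField.classNumber K} ⊆
      ↑(insert (-(X : ℤ)) G) := by
    intro d hd
    obtain ⟨hsq, hdX, K, iF, iN, hK, hdK, h4, hH, hp⟩ := hd
    rw [Finset.coe_insert, Set.mem_insert_iff, Finset.mem_coe]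
    by_cases hdx : d = -(X : ℤ)
    · exact Or.inl hdx
    right
    have hneg : d < 0 := hdK ▸ hK.discr_neg
    have hodd : Odd d := hdK ▸ odd_discr_of_squarefree hK (hdK ▸ hsq)
    have h41 : d % 4 = 1 := by
      obtain ⟨k, hk⟩ := hodd
      have : d % 4 = 1 ∨ d % 4 = 3 := by omega
      rcases this with h | h
      · exact h
      · -- `d ≡ 3 (mod 4)` is impossible for a discriminant `t² + 4m`
        exfalso
        obtain ⟨b, hb⟩ := exists_basis_zero_eq_one (K := K) hK.1
        have hDK := discr_eq_sq_add_four_mul b hb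
        rw [hdK] at hDK
        have hsq4 : (b.repr (b 1 * b 1) 1) ^ 2 % 4 = 0 ∨ (b.repr (b 1 * b 1) 1) ^ 2 % 4 = 1 := by
          rcases Int.emod_two_eq_zero_or_one (b.repr (b 1 * b 1) 1) with he | he
          · left
            obtain ⟨k', hk'⟩ : (2 : ℤ) ∣ b.repr (b 1 * b 1) 1 := Int.dvd_of_emod_eq_zero he
            rw [hk']; ring_nf; omega
          · right
            have : ∃ k' : ℤ, b.repr (b 1 * b 1) 1 = 2 * k' + 1 := ⟨b.repr (b 1 * b 1) 1 / 2, by omega⟩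
            obtain ⟨k', hk'⟩ := this
            rw [hk']; ring_nf; omega
        omega
    have hmem : d ∈ negFundDiscrs X := by
      rw [mem_negFundDiscrs]
      refine ⟨⟨?_, hneg⟩, Or.inl ⟨h41, hsq, by omega⟩⟩
      have := abs_le.mp hdX
      omega
    rw [hG, Finset.mem_filter, Finset.mem_filter]
    refine ⟨⟨hmem, hodd, K, iF, iN, hK, hdK, hH⟩, ?_⟩
    rwa [← ClassNumberValues.dvd_classNumber_iff_of_discr_eq hK.1 hdK hneg rfl p]
  have h := Set.ncard_le_ncard hsub (Finset.finite_toSet _)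
  rw [Set.ncard_coe_finset] at h
  rw [Nat.card_coe_set_eq]
  exact h.trans (Finset.card_insert_le _ _)

/-! ## §3 C⁺ ⟹ positive upper density -/

/-- ★ **C⁺(N, p) ⟹ `p ∤ h(D)` has positive upper density (relative to `X`) over the odd Heegner family of level `N`.**
[cite: Cox2013, §7.B Thm. 7.7(ii)] [cite: arXiv250317619, §1] -/
theorem frequently_mul_le_card_indivisible_of_nonNull {N p : ℕ}
    (hC : ¬ twistDensity (fun d : ℤ ↦ ∃ (K : Type) (_ : Field K) (_ : NumberField K),
      IsImaginaryQuadratic K ∧ NumberField.discr K = d ∧ 4 < d.natAbs ∧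
      SatisfiesHeegnerHypothesis N K ∧ ¬ p ∣ NumberField.classNumber K) 0) :
    ∃ ε : ℝ, 0 < ε ∧ ∃ᶠ X : ℕ in atTop, ε * (X : ℝ) ≤
      ((((negFundDiscrs X).filter (fun D => Odd D ∧ ∃ (K : Type) (_ : Field K) (_ : NumberField K),
        IsImaginaryQuadratic K ∧ NumberField.discr K = D ∧ SatisfiesHeegnerHypothesis N K)).filter
        (fun D => ¬ p ∣ BinQF.classNumber D)).card : ℝ) := by
  unfold twistDensity at hC
  set Num : ℕ → ℝ := fun X => (Nat.card {d : ℤ | Squarefree d ∧ |d| ≤ (X : ℤ) ∧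
      ∃ (K : Type) (_ : Field K) (_ : NumberField K), IsImaginaryQuadratic K ∧
        NumberField.discr K = d ∧ 4 < d.natAbs ∧ SatisfiesHeegnerHypothesis N K ∧
        ¬ p ∣ NumberField.classNumber K} : ℝ) with hNum
  set Den : ℕ → ℝ := fun X => (Nat.card {d : ℤ | Squarefree d ∧ |d| ≤ (X : ℤ)} : ℝ) with hDen
  set Gc : ℕ → ℝ := fun X => ((((negFundDiscrs X).filter (fun D => Odd D ∧ ∃ (K : Type) (_ : Field K) (_ : NumberField K),
        IsImaginaryQuadratic K ∧ NumberField.discr K = D ∧ SatisfiesHeegnerHypothesis N K)).filter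
        (fun D => ¬ p ∣ BinQF.classNumber D)).card : ℝ) with hGc
  obtain ⟨δ, hδ0, hfreq⟩ := exists_pos_frequently_le_of_not_tendsto_zero (u := fun X ↦ Num X / Den X)
    (fun X ↦ by positivity) hC
  obtain ⟨c, hc0, hden⟩ := exists_pos_eventually_mul_le_natCard_squarefree_abs_le
  refine ⟨δ * c / 2, by positivity, ?_⟩
  -- eventually `X` is large enough that `δ c X / 2 ≥ 1`
  have hlarge : ∀ᶠ X : ℕ in atTop, 1 ≤ δ * c / 2 * (X : ℝ) := by
    have ht : Tendsto (fun X : ℕ ↦ δ * c / 2 * (X : ℝ)) atTop atTop :=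
      tendsto_natCast_atTop_atTop.const_mul_atTop (by positivity)
    exact ht.eventually_ge_atTop 1
  refine (hfreq.and_eventually (hden.and hlarge)).mono fun X ⟨hX, hdX, hlX⟩ ↦ ?_
  have hXpos : (0 : ℝ) < X := by
    by_contra hx
    push Not at hx
    have : δ * c / 2 * (X : ℝ) ≤ 0 := mul_nonpos_of_nonneg_of_nonpos (by positivity) hx
    linarith
  have hDenpos : 0 < Den X := lt_of_lt_of_le (mul_pos hc0 hXpos) hdX
  have hNum : δ * Den X ≤ Num X := (le_div_iff₀ hDenpos).mp hX
  have hNumG : Num X ≤ Gc X + 1 := by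
    have h := natCard_cplusSet_le_card_indivisible_add_one N p X
    have h' : (Nat.card {d : ℤ | Squarefree d ∧ |d| ≤ (X : ℤ) ∧
        ∃ (K : Type) (_ : Field K) (_ : NumberField K), IsImaginaryQuadratic K ∧
          NumberField.discr K = d ∧ 4 < d.natAbs ∧ SatisfiesHeegnerHypothesis N K ∧
          ¬ p ∣ NumberField.classNumber K} : ℝ) ≤ (((((negFundDiscrs X).filter (fun D => Odd D ∧ ∃ (K : Type) (_ : Field K) (_ : NumberField K),
        IsImaginaryQuadratic K ∧ NumberField.discr K = D ∧ SatisfiesHeegnerHypothesis N K)).filter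
        (fun D => ¬ p ∣ BinQF.classNumber D)).card + 1 : ℕ) : ℝ) := by
      exact_mod_cast h
    push_cast at h'
    exact h'
  have hchain : δ * c * (X : ℝ) ≤ Gc X + 1 :=
    calc δ * c * (X : ℝ) = δ * (c * X) := by ring
      _ ≤ δ * Den X := by gcongr
      _ ≤ Num X := hNum
      _ ≤ Gc X + 1 := hNumG
  linarith

/-! ## §4 Positive upper density ⟹ C⁺ (through the moment bridge) -/

/-- ★ **`p ∤ h(D)` with positive upper RELATIVE density in the odd Heegner family of level `N` ⟹ C⁺(N, p)** (`N ≠ 0`, `p` prime): the moment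
bridge with the statistic `t(D) = p·[p ∣ h(D)]` and the bound `M = p(1 − ε) < p`. [cite: Cox2013, §7.B Thm. 7.7(ii)] [cite: arXiv250317619, §1] -/
theorem nonNull_of_frequently_mul_card_le_card_indivisible {N p : ℕ} (hN : N ≠ 0) (hp : p.Prime) {ε : ℝ} (hε : 0 < ε)
    (hfreq : ∃ᶠ X : ℕ in atTop,
      ε * (((negFundDiscrs X).filter (fun D => Odd D ∧ ∃ (K : Type) (_ : Field K) (_ : NumberField K),
          IsImaginaryQuadratic K ∧ NumberField.discr K = D ∧ SatisfiesHeegnerHypothesis N K)).card : ℝ) ≤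
        ((((negFundDiscrs X).filter (fun D => Odd D ∧ ∃ (K : Type) (_ : Field K) (_ : NumberField K),
          IsImaginaryQuadratic K ∧ NumberField.discr K = D ∧ SatisfiesHeegnerHypothesis N K)).filter
          (fun D => ¬ p ∣ BinQF.classNumber D)).card : ℝ)) :
    ¬ twistDensity (fun d : ℤ ↦ ∃ (K : Type) (_ : Field K) (_ : NumberField K),
      IsImaginaryQuadratic K ∧ NumberField.discr K = d ∧ 4 < d.natAbs ∧
      SatisfiesHeegnerHypothesis N K ∧ ¬ p ∣ NumberField.classNumber K) 0 := by
  set t : ℤ → ℕ := fun D => if p ∣ BinQF.classNumber D then p else 0 with htdef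
  have ht : ∀ (D : ℤ) (K : Type) [Field K] [NumberField K], IsImaginaryQuadratic K →
      NumberField.discr K = D → p ∣ NumberField.classNumber K → p ≤ t D := by
    intro D K _ _ hK hdK hpK
    have hD0 : D < 0 := hdK ▸ hK.discr_neg
    have hpD : p ∣ BinQF.classNumber D := (ClassNumberValues.dvd_classNumber_iff_of_discr_eq hK.1 hdK hD0 rfl p).mp hpK
    simp [htdef, hpD]
  have hp0 : (0 : ℝ) < p := by exact_mod_cast hp.pos
  refine not_twistDensity_zero_of_frequently_moment_le hN hp.pos t ht (M := (p : ℝ) * (1 - ε)) (by nlinarith) ?_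
  refine hfreq.mono fun X hX ↦ ?_
  set Q := (negFundDiscrs X).filter (fun D => Odd D ∧ ∃ (K : Type) (_ : Field K) (_ : NumberField K),
      IsImaginaryQuadratic K ∧ NumberField.discr K = D ∧ SatisfiesHeegnerHypothesis N K) with hQ
  -- `Σ_Q t = p · #{D ∈ Q : p ∣ h(D)} = p · (#Q − #{p ∤ h})`
  have hsum : (∑ D ∈ Q, (t D : ℝ)) = (p : ℝ) * ((Q.filter fun D => p ∣ BinQF.classNumber D).card : ℝ) := by
    rw [Finset.card_filter, Nat.cast_sum, Finset.mul_sum]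
    refine Finset.sum_congr rfl fun D _ ↦ ?_
    simp only [htdef]
    split_ifs <;> simp
  have hsplit : ((Q.filter fun D => p ∣ BinQF.classNumber D).card : ℝ) =
      (Q.card : ℝ) - ((Q.filter fun D => ¬ p ∣ BinQF.classNumber D).card : ℝ) := by
    have h := Finset.card_filter_add_card_filter_not (s := Q) (fun D => p ∣ BinQF.classNumber D)
    have h' : (((Q.filter fun D => p ∣ BinQF.classNumber D).card +
        (Q.filter fun D => ¬ p ∣ BinQF.classNumber D).card : ℕ) : ℝ) = (Q.card : ℝ) := by exact_mod_cast h
    push_cast at h'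
    linarith
  rw [hsum, hsplit]
  nlinarith [hX, hp0]

/-- **Relative to `X` instead of the family** (`#Q_N(X) ≤ X`). [cite: Cox2013, §7.B Thm. 7.7(ii)] [cite: arXiv250317619, §1] -/
theorem nonNull_of_frequently_mul_le_card_indivisible {N p : ℕ} (hN : N ≠ 0) (hp : p.Prime) {ε : ℝ} (hε : 0 < ε)
    (hfreq : ∃ᶠ X : ℕ in atTop, ε * (X : ℝ) ≤
      ((((negFundDiscrs X).filter (fun D => Odd D ∧ ∃ (K : Type) (_ : Field K) (_ : NumberField K),
        IsImaginaryQuadratic K ∧ NumberField.discr K = D ∧ SatisfiesHeegnerHypothesis N K)).filter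
        (fun D => ¬ p ∣ BinQF.classNumber D)).card : ℝ)) :
    ¬ twistDensity (fun d : ℤ ↦ ∃ (K : Type) (_ : Field K) (_ : NumberField K),
      IsImaginaryQuadratic K ∧ NumberField.discr K = d ∧ 4 < d.natAbs ∧
      SatisfiesHeegnerHypothesis N K ∧ ¬ p ∣ NumberField.classNumber K) 0 := by
  refine nonNull_of_frequently_mul_card_le_card_indivisible hN hp hε (hfreq.mono fun X hX ↦ ?_)
  refine le_trans ?_ hX
  gcongr
  exact_mod_cast card_oddHeegnerFamily_le N X

/-! ## §5 The equivalences -/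

/-- ★★ **C⁺(N, p) ⟺ positive upper density of `p ∤ h(D)` (relative to `X`) over the odd Heegner family of level `N`** (`N ≠ 0`, `p` prime).
[cite: Cox2013, §7.B Thm. 7.7(ii)] [cite: arXiv250317619, §1] -/
theorem nonNull_iff_frequently_mul_le_card_indivisible {N p : ℕ} (hN : N ≠ 0) (hp : p.Prime) :
    (¬ twistDensity (fun d : ℤ ↦ ∃ (K : Type) (_ : Field K) (_ : NumberField K),
      IsImaginaryQuadratic K ∧ NumberField.discr K = d ∧ 4 < d.natAbs ∧
      SatisfiesHeegnerHypothesis N K ∧ ¬ p ∣ NumberField.classNumber K) 0) ↔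
    ∃ ε : ℝ, 0 < ε ∧ ∃ᶠ X : ℕ in atTop, ε * (X : ℝ) ≤
      ((((negFundDiscrs X).filter (fun D => Odd D ∧ ∃ (K : Type) (_ : Field K) (_ : NumberField K),
        IsImaginaryQuadratic K ∧ NumberField.discr K = D ∧ SatisfiesHeegnerHypothesis N K)).filter
        (fun D => ¬ p ∣ BinQF.classNumber D)).card : ℝ) :=
  ⟨frequently_mul_le_card_indivisible_of_nonNull,
    fun ⟨_, hε, hfreq⟩ ↦ nonNull_of_frequently_mul_le_card_indivisible hN hp hε hfreq⟩

/-- ★★ **C⁺(N, p) ⟺ positive upper density of `p ∤ h(D)` RELATIVE TO THE FAMILY** (`N ≠ 0`, `p` prime) — the reading «R1» of the ideation memos.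
[cite: Cox2013, §7.B Thm. 7.7(ii)] [cite: arXiv250317619, §1] -/
theorem nonNull_iff_frequently_mul_card_le_card_indivisible {N p : ℕ} (hN : N ≠ 0) (hp : p.Prime) :
    (¬ twistDensity (fun d : ℤ ↦ ∃ (K : Type) (_ : Field K) (_ : NumberField K),
      IsImaginaryQuadratic K ∧ NumberField.discr K = d ∧ 4 < d.natAbs ∧
      SatisfiesHeegnerHypothesis N K ∧ ¬ p ∣ NumberField.classNumber K) 0) ↔
    ∃ ε : ℝ, 0 < ε ∧ ∃ᶠ X : ℕ in atTop,
      ε * (((negFundDiscrs X).filter (fun D => Odd D ∧ ∃ (K : Type) (_ : Field K) (_ : NumberField K),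
          IsImaginaryQuadratic K ∧ NumberField.discr K = D ∧ SatisfiesHeegnerHypothesis N K)).card : ℝ) ≤
        ((((negFundDiscrs X).filter (fun D => Odd D ∧ ∃ (K : Type) (_ : Field K) (_ : NumberField K),
          IsImaginaryQuadratic K ∧ NumberField.discr K = D ∧ SatisfiesHeegnerHypothesis N K)).filter
          (fun D => ¬ p ∣ BinQF.classNumber D)).card : ℝ) := by
  constructor
  · intro hC
    obtain ⟨ε, hε, hfreq⟩ := frequently_mul_le_card_indivisible_of_nonNull hC
    refine ⟨ε, hε, hfreq.mono fun X hX ↦ le_trans ?_ hX⟩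
    gcongr
    exact_mod_cast card_oddHeegnerFamily_le N X
  · rintro ⟨ε, hε, hfreq⟩
    exact nonNull_of_frequently_mul_card_le_card_indivisible hN hp hε hfreq

end Summit.BirchSwinnertonDyer.BirchSwinnertonDyer.Theorems.BiquadraticEisensteinDescentHeegnerTwistCouplingInSupplyNonNullIffUpperDensity

end
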